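import Summits.ValiantsHypothesis.ValiantsHypothesis.Theses.SummationBits
import Summits.ValiantsHypothesis.ValiantsHypothesis.Theorems.SummationBitsRyserToThesis
import Summits.ValiantsHypothesis.ValiantsHypothesis.Theorems.SummationBitsRyserOptimalDepth3GradedHeart

/-!
# Strategy census companion — crux `SummationBits.RyserOptimalDepth3` (stmt-ValiantsHypothesis-7565)

Typed artefacts of the REDIRECT strategist r1 (unit `cstrat-stmt-ValiantsHypothesis-7565-r1`, 2026-08-17).
Everything here is sorry-free.

* §1 `summit_of_ryserOptimal` — **C → S is certified**: the crux implies `ValiantsHypothesis` through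
  LANDED theorems only (`ryserToThesis_proof`, `SPSNormalForm_holds`, `Depth3Chasm_holds`,
  `Assembly_holds` + three tree facts).  The crux is a certified STRENGTHENING of the summit.
* §2 the degree-threshold split `LowPiece φ ∧ HighPiece φ ↔ C` (assembly proved both ways) and the
  padding lemma `exists_pad` (an `(r, D)` expression is an `(r, D+m)` expression), which turns every
  degree threshold into a pure top-fan-in threshold.
* §3 **both pieces are summit-strength** at the threshold `φ n = 2^(n/2)`:
  `summit_of_lowPiece`, `summit_of_highPiece` (kernel-checked).  Informally (census §Decomposition):
  every piece of every finite case split of the `(n, r, D)`-space that still covers the padded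
  chasm up-set `{r, D ≥ (n+2)^(c√n+c)}` for unboundedly many `c` implies `Depth3Thesis`, hence S.
* §4 the negation, typed: `CounterexampleFamily ↔ ¬ C`.
* §5 rungs that are NOT summit-strength (typed only; ladder material, not pieces of C):
  `TopFanInRung`, `NearHomogeneousRung`, `SymmetricModelRung`, `GlynnModelBound`.
-/

set_option linter.dupNamespace false

namespace Summit.ValiantsHypothesis.ValiantsHypothesis.Cruxes.RyserOptimalDepth3.Strategist

open MvPolynomial
open Literature.Computability.AlgebraicComplexity
open Summit.ValiantsHypothesis.ValiantsHypothesis.Theses.SummationBits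
open Summit.ValiantsHypothesis.ValiantsHypothesis.Theorems
open scoped BigOperators

/-! ## §1  C → S, certified -/

/-- `RyserOptimalDepth3 → Depth3Thesis` from landed theorems (items 7567, 5939). -/
theorem depth3Thesis_of_ryserOptimal (h : RyserOptimalDepth3) : Depth3Thesis :=
  ryserToThesis_proof h SPSNormalForm_holds

/-- From the shared target to the summit, by landed theorems (items 5941, 5935 + tree facts). -/
theorem summit_of_depth3Thesis (h : Depth3Thesis) : _root_.ValiantsHypothesis :=
  Assembly_holds Depth3Chasm_holds h
    (fun n => by rw [totalDegree_perPoly_holds (n := Fin n) (k := ℂ), Fintype.card_fin])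
    (mem_VP_ofFintype_iff_holds _) (perFamily_mem_VNP_holds ℂ)

/-- **C → S (certified strengthening).** -/
theorem summit_of_ryserOptimal (h : RyserOptimalDepth3) : _root_.ValiantsHypothesis :=
  summit_of_depth3Thesis (depth3Thesis_of_ryserOptimal h)

/-! ## §2  The degree-threshold split and padding -/

/-- Low-degree piece of the crux at threshold `φ`: the `2^n/poly` bound for expressions with `D ≤ φ n`. -/
def LowPiece (φ : ℕ → ℕ) : Prop :=
  ∃ c : ℕ, ∀ n : ℕ, 1 ≤ n → ∀ (r D : ℕ) (ℓ : Fin r → Fin D → MvPolynomial (Fin n × Fin n) ℂ),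
    (∀ i j, (ℓ i j).totalDegree ≤ 1) → (∑ i, ∏ j, ℓ i j) = perPoly (Fin n) ℂ →
      D ≤ φ n → 2 ^ n ≤ r * (D + 1) * (n + 2) ^ c

/-- High-degree piece of the crux at threshold `φ`: the `2^n/poly` bound for expressions with `φ n < D`
(by `exists_pad` this is a pure TOP-FAN-IN lower bound `r ≥ 2^n/((φ n + 2)(n+2)^c)`). -/
def HighPiece (φ : ℕ → ℕ) : Prop :=
  ∃ c : ℕ, ∀ n : ℕ, 1 ≤ n → ∀ (r D : ℕ) (ℓ : Fin r → Fin D → MvPolynomial (Fin n × Fin n) ℂ),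
    (∀ i j, (ℓ i j).totalDegree ≤ 1) → (∑ i, ∏ j, ℓ i j) = perPoly (Fin n) ℂ →
      φ n < D → 2 ^ n ≤ r * (D + 1) * (n + 2) ^ c

/-- Assembly of the split (proved): `LowPiece φ → HighPiece φ → RyserOptimalDepth3`. -/
theorem ryserOptimal_of_pieces (φ : ℕ → ℕ) (hL : LowPiece φ) (hH : HighPiece φ) :
    RyserOptimalDepth3 := by
  obtain ⟨c₁, h₁⟩ := hL
  obtain ⟨c₂, h₂⟩ := hH
  refine ⟨c₁ + c₂, fun n hn r D ℓ hℓ hsum => ?_⟩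
  have hmono : ∀ c : ℕ, c ≤ c₁ + c₂ → 2 ^ n ≤ r * (D + 1) * (n + 2) ^ c →
      2 ^ n ≤ r * (D + 1) * (n + 2) ^ (c₁ + c₂) := fun c hc h =>
    h.trans (Nat.mul_le_mul_left _ (Nat.pow_le_pow_right (by omega) hc))
  by_cases hD : D ≤ φ n
  · exact hmono c₁ (by omega) (h₁ n hn r D ℓ hℓ hsum hD)
  · exact hmono c₂ (by omega) (h₂ n hn r D ℓ hℓ hsum (by omega))

/-- Converse (trivial): the crux gives both pieces. -/
theorem pieces_of_ryserOptimal (φ : ℕ → ℕ) (h : RyserOptimalDepth3) : LowPiece φ ∧ HighPiece φ := by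
  obtain ⟨c, hc⟩ := h
  exact ⟨⟨c, fun n hn r D ℓ hℓ hsum _ => hc n hn r D ℓ hℓ hsum⟩,
    ⟨c, fun n hn r D ℓ hℓ hsum _ => hc n hn r D ℓ hℓ hsum⟩⟩

theorem ryserOptimal_iff_pieces (φ : ℕ → ℕ) : RyserOptimalDepth3 ↔ LowPiece φ ∧ HighPiece φ :=
  ⟨pieces_of_ryserOptimal φ, fun h => ryserOptimal_of_pieces φ h.1 h.2⟩

/-- **Padding.** An affine ΣΠΣ expression with parameters `(r, D)` is one with parameters `(r, D + m)`
(append `m` factors equal to `1`). Hence degree thresholds are top-fan-in thresholds. -/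
theorem exists_pad {σ : Type*} {r D : ℕ} (ℓ : Fin r → Fin D → MvPolynomial σ ℂ)
    (hℓ : ∀ i j, (ℓ i j).totalDegree ≤ 1) (m : ℕ) :
    ∃ ℓ' : Fin r → Fin (D + m) → MvPolynomial σ ℂ,
      (∀ i j, (ℓ' i j).totalDegree ≤ 1) ∧ (∑ i, ∏ j, ℓ' i j) = ∑ i, ∏ j, ℓ i j := by
  refine ⟨fun i => Fin.append (ℓ i) (fun _ : Fin m => (1 : MvPolynomial σ ℂ)), ?_, ?_⟩
  · intro i j
    induction j using Fin.addCases with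
    | left j => simpa using hℓ i j
    | right j => simp
  · refine Finset.sum_congr rfl fun i _ => ?_
    rw [Fin.prod_univ_add]
    simp

/-! ## §3  Both pieces are summit-strength at `φ n = 2^(n/2)` -/

/-- Arithmetic core shared by both pieces: from the growth witness, `B := (n+2)^(c√n+c)` satisfies
`B² (n+2)^e < 2^n`. -/
private theorem sq_bound {n c e : ℕ}
    (hlt : (n + 2) ^ (2 * c * Nat.sqrt n + (2 * c + e)) < 2 ^ n) :
    (n + 2) ^ (c * Nat.sqrt n + c) * (n + 2) ^ (c * Nat.sqrt n + c) * (n + 2) ^ e < 2 ^ n := by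
  have : (n + 2) ^ (c * Nat.sqrt n + c) * (n + 2) ^ (c * Nat.sqrt n + c) * (n + 2) ^ e
      = (n + 2) ^ (2 * c * Nat.sqrt n + (2 * c + e)) := by
    rw [← pow_add, ← pow_add]; ring_nf
  rw [this]; exact hlt

/-- If `x * x < 2^n` then `x < 2^(n - n/2)`. -/
private theorem lt_two_pow_half_up {x n : ℕ} (h : x * x < 2 ^ n) : x < 2 ^ (n - n / 2) := by
  by_contra hx
  have hx : 2 ^ (n - n / 2) ≤ x := not_lt.mp hx
  have h1 : 2 ^ (n - n / 2) * 2 ^ (n - n / 2) ≤ x * x := Nat.mul_le_mul hx hx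
  have h2 : 2 ^ n ≤ 2 ^ (n - n / 2) * 2 ^ (n - n / 2) := by
    rw [← pow_add]; exact Nat.pow_le_pow_right (by norm_num) (by omega)
  omega

/-- If `2^(n/2) ≤ x` then `2^n ≤ 2 * (x * x)`. -/
private theorem two_pow_le_of_half_le {x n : ℕ} (hx : 2 ^ (n / 2) ≤ x) : 2 ^ n ≤ 2 * (x * x) := by
  have h1 : 2 ^ (n / 2) * 2 ^ (n / 2) ≤ x * x := Nat.mul_le_mul hx hx
  have h2 : 2 ^ n ≤ 2 * (2 ^ (n / 2) * 2 ^ (n / 2)) := by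
    rw [← pow_add, ← pow_succ']; exact Nat.pow_le_pow_right (by norm_num) (by omega)
  exact h2.trans (Nat.mul_le_mul_left _ h1)

/-- **The low-degree piece at `φ n = 2^(n/2)` already implies the shared target** (the chasm normal
form has `D = E + 1 ≤ (n+2)^(c√n+c) + 1 ≤ 2^(n/2)` at the growth witness). -/
theorem depth3Thesis_of_lowPiece (h : LowPiece fun n => 2 ^ (n / 2)) : Depth3Thesis := by
  obtain ⟨c₀, hc₀⟩ := h
  intro c
  obtain ⟨n, hn1, hlt⟩ := ryserToThesis_growth (2 * c) (2 * c + (c₀ + 3))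
  refine ⟨n, fun P hP hd => ?_⟩
  by_contra hle
  have hle : P.edgeSize ≤ (n + 2) ^ (c * Nat.sqrt n + c) := not_lt.mp hle
  obtain ⟨ℓ, hℓ, hsum⟩ := SPSNormalForm_holds n P hP hd
  set B : ℕ := (n + 2) ^ (c * Nat.sqrt n + c) with hB
  have hB1 : 1 ≤ B := Nat.one_le_pow _ _ (by omega)
  have hBB : 1 ≤ B * B := Nat.mul_le_mul hB1 hB1
  have hsq : B * B * (n + 2) ^ (c₀ + 3) < 2 ^ n := sq_bound hlt
  have hN3 : 8 ≤ (n + 2) ^ 3 :=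
    calc (8 : ℕ) = 2 ^ 3 := by norm_num
      _ ≤ (n + 2) ^ 3 := Nat.pow_le_pow_left (by omega) 3
  have hP1 : 1 ≤ (n + 2) ^ c₀ := Nat.one_le_pow _ _ (by omega)
  have h8 : 8 * (B * B) ≤ B * B * (n + 2) ^ (c₀ + 3) :=
    calc 8 * (B * B) = B * B * (1 * 8) := by ring
      _ ≤ B * B * ((n + 2) ^ c₀ * (n + 2) ^ 3) := Nat.mul_le_mul_left _ (Nat.mul_le_mul hP1 hN3)
      _ = B * B * (n + 2) ^ (c₀ + 3) := by rw [pow_add]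
  -- (i) D = E + 1 ≤ 2^(n/2): otherwise 2^n ≤ 2 B² < 8 B² ≤ B² (n+2)^(c₀+3) < 2^n
  have hD : P.edgeSize + 1 ≤ 2 ^ (n / 2) := by
    by_contra hD
    have hD' : 2 ^ (n / 2) ≤ B := by omega
    have h1 : 2 ^ n ≤ 2 * (B * B) := two_pow_le_of_half_le hD'
    have h2 : 2 * (B * B) < 8 * (B * B) := by omega
    exact Nat.lt_irrefl _ (h1.trans_lt (h2.trans_le (h8.trans hsq.le)))
  have h2n := hc₀ n hn1 (P.edgeSize + 1) (P.edgeSize + 1) ℓ hℓ hsum hD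
  -- (ii) the Ryser contradiction, as in `ryserToThesis_proof`
  have hbound : (P.edgeSize + 1) * (P.edgeSize + 1 + 1) * (n + 2) ^ c₀ < 2 ^ n :=
    calc (P.edgeSize + 1) * (P.edgeSize + 1 + 1) * (n + 2) ^ c₀
        ≤ (B + 1) * (B + 1 + 1) * (n + 2) ^ c₀ := by gcongr
      _ ≤ 6 * (B * B) * (n + 2) ^ c₀ := by
          apply Nat.mul_le_mul_right
          nlinarith [hB1]
      _ ≤ 8 * (B * B) * (n + 2) ^ c₀ :=
          Nat.mul_le_mul_right _ (Nat.mul_le_mul_right _ (by norm_num))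
      _ = B * B * ((n + 2) ^ c₀ * 8) := by ring
      _ ≤ B * B * ((n + 2) ^ c₀ * (n + 2) ^ 3) :=
          Nat.mul_le_mul_left _ (Nat.mul_le_mul_left _ hN3)
      _ = B * B * (n + 2) ^ (c₀ + 3) := by rw [pow_add]
      _ < 2 ^ n := hsq
  exact absurd h2n (not_le.mpr hbound)

/-- **The high-degree piece at `φ n = 2^(n/2)` also implies the shared target**: pad the chasm normal
form to `D = E + 1 + 2^(n/2)`; the piece then forces `2^(n/2)/poly ≤ r = E + 1`, absurd. -/
theorem depth3Thesis_of_highPiece (h : HighPiece fun n => 2 ^ (n / 2)) : Depth3Thesis := by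
  obtain ⟨c₀, hc₀⟩ := h
  intro c
  obtain ⟨n, hn1, hlt⟩ := ryserToThesis_growth (2 * c) (2 * c + (2 * c₀ + 6))
  refine ⟨n, fun P hP hd => ?_⟩
  by_contra hle
  have hle : P.edgeSize ≤ (n + 2) ^ (c * Nat.sqrt n + c) := not_lt.mp hle
  obtain ⟨ℓ, hℓ, hsum⟩ := SPSNormalForm_holds n P hP hd
  obtain ⟨ℓ', hℓ', hsum'⟩ := exists_pad ℓ hℓ (2 ^ (n / 2))
  have h2n := hc₀ n hn1 (P.edgeSize + 1) (P.edgeSize + 1 + 2 ^ (n / 2)) ℓ' hℓ' (hsum'.trans hsum)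
    (show 2 ^ (n / 2) < P.edgeSize + 1 + 2 ^ (n / 2) by omega)
  -- abbreviations (Nat-level only)
  obtain ⟨E, hE⟩ : ∃ E : ℕ, E = P.edgeSize := ⟨_, rfl⟩
  obtain ⟨S, hS⟩ : ∃ S : ℕ, S = 2 ^ (n / 2) := ⟨_, rfl⟩
  rw [← hE] at h2n hle
  rw [← hS] at h2n
  set B : ℕ := (n + 2) ^ (c * Nat.sqrt n + c) with hB
  set P₀ : ℕ := (n + 2) ^ c₀ with hP₀
  have hB1 : 1 ≤ B := Nat.one_le_pow _ _ (by omega)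
  have hP1 : 1 ≤ P₀ := Nat.one_le_pow _ _ (by omega)
  have hsq : B * B * (n + 2) ^ (2 * c₀ + 6) < 2 ^ n := sq_bound hlt
  have hN4 : 16 ≤ (n + 2) ^ 4 :=
    calc (16 : ℕ) = 2 ^ 4 := by norm_num
      _ ≤ (n + 2) ^ 4 := Nat.pow_le_pow_left (by omega) 4
  have hN2 : 1 ≤ (n + 2) ^ 2 := Nat.one_le_pow _ _ (by omega)
  have hpow : (n + 2) ^ (2 * c₀ + 6) = (n + 2) ^ 4 * (n + 2) ^ 2 * (P₀ * P₀) := by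
    rw [hP₀, ← pow_add, ← pow_add, ← pow_add]; ring_nf
  have hE2 : E + 1 ≤ 2 * B := by omega
  have hE3 : E + 2 ≤ 3 * B := by omega
  -- T1 := (E+1)(E+2) P₀ : 2·T1 ≤ 12 B² P₀ ≤ B² (n+2)^(2c₀+6) < 2^n
  have hT1 : 2 * ((E + 1) * (E + 2) * P₀) < 2 ^ n := by
    have h1 : (E + 1) * (E + 2) ≤ 2 * B * (3 * B) := Nat.mul_le_mul hE2 hE3
    have h2 : 2 * ((E + 1) * (E + 2) * P₀) ≤ B * B * (12 * P₀) :=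
      calc 2 * ((E + 1) * (E + 2) * P₀) = 2 * ((E + 1) * (E + 2)) * P₀ := by ring
        _ ≤ 2 * (2 * B * (3 * B)) * P₀ :=
            Nat.mul_le_mul_right _ (Nat.mul_le_mul_left _ h1)
        _ = B * B * (12 * P₀) := by ring
    have h3 : 12 * P₀ ≤ (n + 2) ^ 4 * (n + 2) ^ 2 * (P₀ * P₀) :=
      calc 12 * P₀ ≤ 16 * P₀ := Nat.mul_le_mul_right _ (by norm_num)
        _ = 16 * 1 * (P₀ * 1) := by ring
        _ ≤ (n + 2) ^ 4 * (n + 2) ^ 2 * (P₀ * P₀) :=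
            Nat.mul_le_mul (Nat.mul_le_mul hN4 hN2) (Nat.mul_le_mul_left _ hP1)
    have h4 : B * B * (12 * P₀) ≤ B * B * (n + 2) ^ (2 * c₀ + 6) := by
      rw [hpow]; exact Nat.mul_le_mul_left _ h3
    exact lt_of_le_of_lt (h2.trans h4) hsq
  -- T2 := (E+1) S P₀ : with x := 4 B P₀, x² < 2^n so x < 2^(n - n/2), and 2·T2 ≤ x·S < 2^n
  have hT2 : 2 * ((E + 1) * S * P₀) < 2 ^ n := by
    have hx2 : (4 * B * P₀) * (4 * B * P₀) < 2 ^ n := by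
      have h3 : (4 * B * P₀) * (4 * B * P₀) ≤ B * B * (n + 2) ^ (2 * c₀ + 6) := by
        rw [hpow]
        calc (4 * B * P₀) * (4 * B * P₀) = B * B * (16 * 1 * (P₀ * P₀)) := by ring
          _ ≤ B * B * ((n + 2) ^ 4 * (n + 2) ^ 2 * (P₀ * P₀)) :=
              Nat.mul_le_mul_left _ (Nat.mul_le_mul_right _ (Nat.mul_le_mul hN4 hN2))
      exact lt_of_le_of_lt h3 hsq
    have hx : 4 * B * P₀ < 2 ^ (n - n / 2) := lt_two_pow_half_up hx2
    have h1 : 2 * ((E + 1) * S * P₀) ≤ (4 * B * P₀) * S :=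
      calc 2 * ((E + 1) * S * P₀) = (2 * (E + 1)) * (S * P₀) := by ring
        _ ≤ (2 * (2 * B)) * (S * P₀) := Nat.mul_le_mul_right _ (by omega)
        _ = (4 * B * P₀) * S := by ring
    have hSpos : 0 < S := by rw [hS]; positivity
    have h2 : (4 * B * P₀) * S < 2 ^ (n - n / 2) * S := Nat.mul_lt_mul_of_pos_right hx hSpos
    have h3 : 2 ^ (n - n / 2) * S = 2 ^ n := by
      rw [hS, ← pow_add]; congr 1; omega
    calc 2 * ((E + 1) * S * P₀) ≤ (4 * B * P₀) * S := h1
      _ < 2 ^ (n - n / 2) * S := h2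
      _ = 2 ^ n := h3
  have hsplit : (E + 1) * (E + 1 + S + 1) * P₀ = (E + 1) * (E + 2) * P₀ + (E + 1) * S * P₀ := by
    ring
  rw [hsplit] at h2n
  omega

/-- Hence both pieces reach the summit (by landed theorems). -/
theorem summit_of_lowPiece (h : LowPiece fun n => 2 ^ (n / 2)) : _root_.ValiantsHypothesis :=
  summit_of_depth3Thesis (depth3Thesis_of_lowPiece h)

theorem summit_of_highPiece (h : HighPiece fun n => 2 ^ (n / 2)) : _root_.ValiantsHypothesis :=
  summit_of_depth3Thesis (depth3Thesis_of_highPiece h)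

/-! ## §4  The negation, typed -/

/-- A counterexample to the crux: for every exponent `c`, some `n ≥ 1` and an affine ΣΠΣ expression of
`per_n` with `r (D+1) (n+2)^c < 2^n` — "Ryser beaten by a super-polynomial factor infinitely often". -/
def CounterexampleFamily : Prop :=
  ∀ c : ℕ, ∃ n : ℕ, 1 ≤ n ∧ ∃ (r D : ℕ) (ℓ : Fin r → Fin D → MvPolynomial (Fin n × Fin n) ℂ),
    (∀ i j, (ℓ i j).totalDegree ≤ 1) ∧ (∑ i, ∏ j, ℓ i j) = perPoly (Fin n) ℂ ∧
      r * (D + 1) * (n + 2) ^ c < 2 ^ n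

theorem counterexampleFamily_iff_not : CounterexampleFamily ↔ ¬ RyserOptimalDepth3 := by
  unfold CounterexampleFamily RyserOptimalDepth3
  push Not
  rfl

/-! ## §5  Rungs that are NOT summit-strength (typed only; ladder material, not pieces)

Each is implied by the crux, none implies it back, and none contains the padded chasm up-set, so none
feeds `closes`; they are recorded for a future FRONTIER ladder, not filed. -/

/-- Top-fan-in rung at scale `ψ`: every affine ΣΠΣ expression of `per_n` (any degree) has `r ≥ ψ n`
eventually.  Summit-strength iff `ψ` beats every `(n+2)^(c√n+c)`; open already for `ψ n = n + 1`
(the subspace-restriction argument needs "`per_n` is not constant on affine subspaces of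
codimension `< n`", not located in print). -/
def TopFanInRung (ψ : ℕ → ℕ) : Prop :=
  ∃ n₀ : ℕ, ∀ n ≥ n₀, ∀ (r D : ℕ) (ℓ : Fin r → Fin D → MvPolynomial (Fin n × Fin n) ℂ),
    (∀ i j, (ℓ i j).totalDegree ≤ 1) → (∑ i, ∏ j, ℓ i j) = perPoly (Fin n) ℂ → ψ n ≤ r

/-- Near-homogeneous rung (lead's R2): Ryser-optimality for `D ≤ 3n`.  Flattenings give `2^(0.35 n)`
there (landed `StubFlatteningRegime.choose_sq_le`), the crux asks `2^n/poly`; `= LowPiece (3n)`. -/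
def NearHomogeneousRung : Prop := LowPiece fun n => 3 * n

/-- Symmetric-model rung (lead's R1, Shpilka 2002): one elementary-symmetric gate of linear forms needs
super-polynomially many forms; record `2n² − 3n` (Shpilka Thm 4.4 argument), flattening `n²`. -/
def SymmetricModelRung : Prop :=
  ∀ c : ℕ, ∃ n₀ : ℕ, ∀ n ≥ n₀, ∀ (D : ℕ) (a : ℂ) (m : Fin D → MvPolynomial (Fin n × Fin n) ℂ),
    (∀ j, (m j).IsHomogeneous 1) → C a * aeval m (esymm (Fin D) ℂ n) = perPoly (Fin n) ℂ →
      (n + 2) ^ c ≤ D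

/-- Glynn's restricted model (Landsberg 2017 Thm 7.4.6.1 = Glynn 2013): row-uniform multilinear
expressions `per_n = Σ_s Π_i (Σ_j λ_{s,j} x_ij)` need `r ≥ 2^(n-1)` — in bijection with Waring
decompositions of `x_1⋯x_n` (Carlini–Catalisano–Geramita 2012).  A THEOREM in print (not in tree);
it is the exact sense in which "coefficient-extraction" constructions cannot beat Glynn. -/
def GlynnModelBound : Prop :=
  ∀ n : ℕ, 1 ≤ n → ∀ (r : ℕ) (lam : Fin r → Fin n → ℂ) (a : Fin r → ℂ),
    (∑ s, C (a s) * ∏ i : Fin n, ∑ j : Fin n, C (lam s j) * X (i, j)) = perPoly (Fin n) ℂ →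
      2 ^ (n - 1) ≤ r

/-- The crux implies the near-homogeneous rung (it is a piece). -/
theorem nearHomogeneousRung_of_ryserOptimal (h : RyserOptimalDepth3) : NearHomogeneousRung :=
  (pieces_of_ryserOptimal _ h).1

end Summit.ValiantsHypothesis.ValiantsHypothesis.Cruxes.RyserOptimalDepth3.Strategist
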